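import Summits.ABC.StewartYu.PadicG3RecordR3
import Summits.ABC.StewartYu.PadicG3OddLogForm
import HarnessLib

/-!
# Cell abc-stewartyu, crux `Y07Odd` (stmt-ABC-19658), line `gen3-slab-odd`: the record's four step FAMILIES of `IneqPackR₃` with the
# `‖Λ‖`-branch discharged DIRECTLY from a logarithmic line (no zeros count in the exponent), over an abstract schedule `Sc`

`Summits/ABC/StewartYu/PadicG3OddLamLines.lean` — cell `abc-stewartyu` (HOME `run/shared/lean/pub/abc-stewartyu/`), seat lp-1 (g4).  Theorems
only; no named fact; no schedule instance, no numbers.  Companion of p5-g4's `PadicG3OddLogForm` (generic part 1).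

Every conjunct of `G3Setup.IneqPackR₃ S Sc` (`PadicG3RecordR3`) is a `max (Λ-branch) (gain branch) < threshold`.  In `PadicG3OddLogForm` the
`Λ`-branch `BwP·‖Λ/b_{j₀}‖·p^{⌊(t−1)/2⌋}·p^{condExp}` is reduced to the gain branch (`first_le_gain_odd`), at the price of an exponent line
`⌊(t−1)/2⌋ + condExp + m·g + ⌈g/2⌉ ≤ E` that charges the family's full zeros count `g = (2N+1)·t` against the smallness exponent `E`.  At the
deep levels of the `m = 0` schedule (`TV` bottomed out, `XsV` still doubling) that count exceeds every budget the negated bound can pay for,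
so this file gives the DIRECT alternative (the odd-`p` port of p3's `TwoSetup.branch_comparison_lt_of_log`):

* `G3OddLog.comparison_lt_of_log` — `Λ ≤ p^{−E}` and `log Bw + (a + c)·log p + log K < E·log p` give `Bw·Λ·p^a·p^c < 1/K`;
* `G3OddLog.half_comparison_lt_of_log` — the half-step threshold `D/(4D²(1+Q)P³)^e` from
  `log Bw + (a + c)·log p + e·(log 4 + 2 log D + log(1+Q) + 3 log P) − log D < E·log p`;
* `G3OddLog.kstep_max_lt_of_lamLines`, `G3OddLog.half_max_lt_of_lamLines` — the `max`-shapes from the `Λ`-line AND the gain line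
  `log Bw + log K < g·(m+½)·log p` (the gain line is the one of `PadicG3OddLogForm`, verbatim);
* `G3Setup.hK0_of_lamLines`, `hO_of_lamLines`, `hK_of_lamLines`, `hH_of_lamLines` — conjuncts 2, 4, 5, 3 of `IneqPackR₃ S Sc` from, per node,
  the `Λ`-line `log BwP + (⌊(tS−1)/2⌋ + condExp)·log p + log KC(…) < E·log p` (half-steps: `… + 2^{n+1}·(log 4 + 2 log DCs + log(1 + U·P·MhCs)
  + 3 log ∏H(α)) − log DCs < E·log p`) and the gain line of p5-g4's `h*_of_lines` (binders and gain hypotheses are byte-identical to those);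
* `G3Setup.ineqPackR₃_of_lamLines` — (B1) ∧ the four families ⇒ `S.IneqPackR₃ Sc`.

WHAT THIS IS NOT: (B1) itself (lp-1 g3's `startCountR₂_*`); the exponent `E` (p2-g4's `PadicG3ExpLine`); the size of any slot (`KC`, `DCs`,
`MhCs`, `condExp` — Part A of the instantiations, p3-g7 / p1 g8 / p4 g4); no crux moves.

References: Yu. V. Nesterenko, LNM 1819 (2003) §4.2 (4.29)–(4.33), §4.3 (4.39)–(4.45); K. Yu, Acta Math. 211 (2013) Lemma 5.2 (5.28)–(5.31).
-/

noncomputable section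

open NormedSpace Finset Polynomial
open Literature.NumberTheory.Transcendental
open Literature.NumberTheory.Transcendental.PadicCW77 (condExp)
open Literature.NumberTheory.Transcendental.CW77.Setup (Tau tauNorm)
open scoped Nat

namespace Summit.ABC.StewartYu

namespace G3OddLog

/-! ### The comparison (`‖Λ‖`-) branch directly from a logarithmic line -/

/-- **The `‖Λ‖`-branch from logs** (odd `p`, any radius): `Λ ≤ p^{−E}` and `log Bw + (a + c)·log p + log K < E·log p` give
`Bw·Λ·p^a·p^c < 1/K`. [cite: Yu2013, Lemma 5.2 (5.28); shape only] -/
theorem comparison_lt_of_log {p : ℝ} (hp : 1 < p) {Bw Λ K : ℝ} (hBw : 0 < Bw) (hK : 0 < K) {a c E : ℕ}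
    (hΛ : Λ ≤ (p ^ E)⁻¹) (hlog : Real.log Bw + ((a + c : ℕ) : ℝ) * Real.log p + Real.log K < E * Real.log p) :
    Bw * Λ * p ^ a * p ^ c < 1 / K := by
  have hp0 : 0 < p := lt_trans zero_lt_one hp
  -- replace `Λ` by `p^{−E}`: the left side is at most `(Bw·p^a·p^c)/p^E`
  have hstep : Bw * Λ * p ^ a * p ^ c ≤ Bw * p ^ a * p ^ c / p ^ E := by
    have e1 : Bw * Λ * p ^ a * p ^ c = Bw * p ^ a * p ^ c * Λ := by ring
    rw [e1, div_eq_mul_inv]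
    exact mul_le_mul_of_nonneg_left hΛ (by positivity)
  refine lt_of_le_of_lt hstep (TwoSetup.branch_gain_lt_of_log (by positivity) hK hp0 ?_)
  rw [Real.log_mul (by positivity) (by positivity), Real.log_mul hBw.ne' (by positivity), Real.log_pow, Real.log_pow]
  push_cast at hlog
  linarith

/-- **The `‖Λ‖`-branch of a half-step from logs**: with `D ≥ 1`, `Q ≥ 0`, `P ≥ 1`, `Λ ≤ p^{−E}` and
`log Bw + (a + c)·log p + e·(log 4 + 2·log D + log(1+Q) + 3·log P) − log D < E·log p` give `Bw·Λ·p^a·p^c < D/(4·D²·(1+Q)·P³)^e`.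
[cite: Nesterenko2003, §4.3 (4.44); shape only] -/
theorem half_comparison_lt_of_log {p : ℝ} (hp : 1 < p) {Bw Λ D Q P : ℝ} (hBw : 0 < Bw) (hD : 1 ≤ D) (hQ : 0 ≤ Q) (hP : 1 ≤ P)
    {a c E e : ℕ} (hΛ : Λ ≤ (p ^ E)⁻¹)
    (hlog : Real.log Bw + ((a + c : ℕ) : ℝ) * Real.log p +
        e * (Real.log 4 + 2 * Real.log D + Real.log (1 + Q) + 3 * Real.log P) - Real.log D < E * Real.log p) :
    Bw * Λ * p ^ a * p ^ c < D / (4 * D ^ 2 * (1 + Q) * P ^ 3) ^ e := by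
  have hp0 : 0 < p := lt_trans zero_lt_one hp
  have hstep : Bw * Λ * p ^ a * p ^ c ≤ Bw * p ^ a * p ^ c / p ^ E := by
    have e1 : Bw * Λ * p ^ a * p ^ c = Bw * p ^ a * p ^ c * Λ := by ring
    rw [e1, div_eq_mul_inv]
    exact mul_le_mul_of_nonneg_left hΛ (by positivity)
  refine lt_of_le_of_lt hstep (gain_lt_threshold_of_log (by positivity) hD hQ hP hp0 ?_)
  rw [Real.log_mul (by positivity) (by positivity), Real.log_mul hBw.ne' (by positivity), Real.log_pow, Real.log_pow]
  push_cast at hlog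
  linarith

/-! ### The `max`-shapes of the packages from the `Λ`-line and the gain line -/

/-- **A k-step inequality (both branches) from its two lines**: smallness `Λ ≤ p^{−E}`, the `Λ`-line
`log Bw + (⌊(t−1)/2⌋ + c)·log p + log K < E·log p` and the gain line `log Bw + log K < g·(m+½)·log p` give
`max (Bw·Λ·p^{⌊(t−1)/2⌋}·p^c) (Bw/(p^m√p)^g) < 1/K`. [cite: Nesterenko2003, §4.2 (4.29)–(4.33); shape only] -/
theorem kstep_max_lt_of_lamLines {p : ℝ} (hp : 1 < p) {Bw Λ K : ℝ} (hBw : 0 < Bw) (hK : 0 < K) {m t c g E : ℕ}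
    (hΛ : Λ ≤ (p ^ E)⁻¹)
    (hlam : Real.log Bw + (((t - 1) / 2 + c : ℕ) : ℝ) * Real.log p + Real.log K < E * Real.log p)
    (hgain : Real.log Bw + Real.log K < g * (((m : ℝ) + 1 / 2) * Real.log p)) :
    max (Bw * Λ * p ^ ((t - 1) / 2) * p ^ c) (Bw / (p ^ m * Real.sqrt p) ^ g) < 1 / K := by
  have hp0 : 0 < p := lt_trans zero_lt_one hp
  have hρ : 0 < p ^ m * Real.sqrt p := by positivity
  refine max_lt (comparison_lt_of_log hp hBw hK hΛ hlam) (TwoSetup.branch_gain_lt_of_log hBw hK hρ ?_)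
  rwa [log_rho hp0 m]

/-- **A half-step inequality (both branches) from its two lines**: smallness, the `Λ`-line
`log Bw + (⌊(t−1)/2⌋ + c)·log p + e·(log 4 + 2 log D + log(1+Q) + 3 log P) − log D < E·log p` and the gain line
`log Bw + e·(…) − log D < g·(m+½)·log p` give `max (Bw·Λ·p^{⌊(t−1)/2⌋}·p^c) (Bw/(p^m√p)^g) < D/(4D²(1+Q)P³)^e`.
[cite: Nesterenko2003, §4.3 (4.44); shape only] -/
theorem half_max_lt_of_lamLines {p : ℝ} (hp : 1 < p) {Bw Λ D Q P : ℝ} (hBw : 0 < Bw) (hD : 1 ≤ D) (hQ : 0 ≤ Q) (hP : 1 ≤ P)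
    {m t c g E e : ℕ} (hΛ : Λ ≤ (p ^ E)⁻¹)
    (hlam : Real.log Bw + (((t - 1) / 2 + c : ℕ) : ℝ) * Real.log p +
        e * (Real.log 4 + 2 * Real.log D + Real.log (1 + Q) + 3 * Real.log P) - Real.log D < E * Real.log p)
    (hgain : Real.log Bw + e * (Real.log 4 + 2 * Real.log D + Real.log (1 + Q) + 3 * Real.log P) - Real.log D <
      g * (((m : ℝ) + 1 / 2) * Real.log p)) :
    max (Bw * Λ * p ^ ((t - 1) / 2) * p ^ c) (Bw / (p ^ m * Real.sqrt p) ^ g) < D / (4 * D ^ 2 * (1 + Q) * P ^ 3) ^ e := by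
  have hp0 : 0 < p := lt_trans zero_lt_one hp
  have hρ : 0 < p ^ m * Real.sqrt p := by positivity
  refine max_lt (half_comparison_lt_of_log hp hBw hD hQ hP hΛ hlam) (gain_lt_threshold_of_log hBw hD hQ hP hρ ?_)
  rwa [log_rho hp0 m]

end G3OddLog

namespace G3Setup

variable {p : ℕ} [Fact p.Prime] (S : G3Setup p) (Sc : G3Sched S.n)

/-! ### Positivity of the closed forms used below -/

omit S in
/-- `0 < BwP`. [folklore] -/
private theorem BwP_pos_aux (L₀ m : ℕ) : 0 < BwP (p := p) L₀ m := by
  have hp : (0 : ℝ) < p := by exact_mod_cast (Fact.out : p.Prime).pos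
  unfold BwP; positivity

/-- `0 < KC U P …` for `P ≥ 0`. [folklore] -/
private theorem KC_pos_aux (U : ℕ) {P : ℤ} (hP : 0 ≤ P) (L₀ H Sh lev : ℕ) (L : Fin S.n → ℕ) (x : ℤ) (τ : Tau S.n) :
    0 < S.KC U P L₀ H Sh lev L x τ := by
  unfold KC
  have hM : (0 : ℝ) ≤ M0C L₀ H Sh lev x τ.1 := by
    have : (0 : ℤ) ≤ M0C L₀ H Sh lev x τ.1 := by unfold M0C; exact Int.ceil_nonneg (by positivity)
    exact_mod_cast this
  have hX : (0 : ℝ) ≤ S.XbC L := by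
    have : (0 : ℤ) ≤ S.XbC L := by
      unfold XbC; exact mul_nonneg (by norm_num) (mul_nonneg (sum_nonneg fun j _ => abs_nonneg _) (sum_nonneg fun j _ => by positivity))
    exact_mod_cast this
  have hP' : (0 : ℝ) ≤ P := by exact_mod_cast hP
  positivity

/-! ### The three k-step families from their `Λ`-lines and gain lines -/

/-- **The level-`0` k-steps (conjunct 2 of `IneqPackR₃`) from their two lines.** [cite: Nesterenko2003, §4.2 (4.29)–(4.33); shape only] -/
theorem hK0_of_lamLines {E : ℕ} (hΛ : ‖S.Λ / (S.b S.j₀ : ℚ_[p])‖ ≤ ((p : ℝ) ^ E)⁻¹)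
    (hlam : ∀ ν < S.n, ∀ x₁ : ℤ, |x₁| ≤ (S.NS Sc 0 (ν + 1) : ℤ) → ∀ τ : Tau S.n, tauNorm τ + S.tS Sc 0 ≤ S.TordS Sc 0 ν →
      Real.log (BwP (p := p) Sc.L₀ Sc.m) +
          ((((S.tS Sc 0 - 1) / 2 + condExp p (2 * S.NS Sc 0 ν + 1) (S.tS Sc 0) : ℕ)) : ℝ) * Real.log p +
          Real.log (S.KC (S.UcardS₂ Sc) (S.PmaxS₂ Sc) Sc.L₀ Sc.H Sc.Sd 0 (S.Lb (S.sideS₂ Sc) 0) x₁ τ) <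
        (E : ℝ) * Real.log p)
    (hgain : ∀ ν < S.n, ∀ x₁ : ℤ, |x₁| ≤ (S.NS Sc 0 (ν + 1) : ℤ) → ∀ τ : Tau S.n, tauNorm τ + S.tS Sc 0 ≤ S.TordS Sc 0 ν →
      Real.log (BwP (p := p) Sc.L₀ Sc.m) + Real.log (S.KC (S.UcardS₂ Sc) (S.PmaxS₂ Sc) Sc.L₀ Sc.H Sc.Sd 0 (S.Lb (S.sideS₂ Sc) 0) x₁ τ) <
        (((2 * S.NS Sc 0 ν + 1) * S.tS Sc 0 : ℕ) : ℝ) * (((Sc.m : ℝ) + 1 / 2) * Real.log p)) :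
    ∀ ν < S.n, ∀ x₁ : ℤ, |x₁| ≤ (S.NS Sc 0 (ν + 1) : ℤ) → ∀ τ : Tau S.n, tauNorm τ + S.tS Sc 0 ≤ S.TordS Sc 0 ν →
      max (BwP (p := p) Sc.L₀ Sc.m * ‖S.Λ / (S.b S.j₀ : ℚ_[p])‖ * (p : ℝ) ^ ((S.tS Sc 0 - 1) / 2) *
            (p : ℝ) ^ condExp p (2 * S.NS Sc 0 ν + 1) (S.tS Sc 0))
        (BwP (p := p) Sc.L₀ Sc.m / ((p : ℝ) ^ Sc.m * Real.sqrt p) ^ ((2 * S.NS Sc 0 ν + 1) * S.tS Sc 0)) <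
      1 / S.KC (S.UcardS₂ Sc) (S.PmaxS₂ Sc) Sc.L₀ Sc.H Sc.Sd 0 (S.Lb (S.sideS₂ Sc) 0) x₁ τ := by
  intro ν hν x₁ hx₁ τ hτ
  exact G3OddLog.kstep_max_lt_of_lamLines S.one_lt_p (BwP_pos_aux Sc.L₀ Sc.m)
    (S.KC_pos_aux _ (S.PmaxS₂_nonneg Sc) _ _ _ _ _ _ _) hΛ (hlam ν hν x₁ hx₁ τ hτ) (hgain ν hν x₁ hx₁ τ hτ)

/-- **The odd-node k-steps (conjunct 4 of `IneqPackR₃`, first step of each level `≥ 1`) from their two lines.**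
[cite: Nesterenko2003, §4.2; shape only] -/
theorem hO_of_lamLines {E : ℕ} (hΛ : ‖S.Λ / (S.b S.j₀ : ℚ_[p])‖ ≤ ((p : ℝ) ^ E)⁻¹)
    (hlam : ∀ lev < Sc.Sd, ∀ x₁ : ℤ, |x₁| ≤ (S.NS Sc (lev + 1) 1 : ℤ) → ∀ τ : Tau S.n, tauNorm τ + S.tS Sc (lev + 1) ≤ S.TordS Sc (lev + 1) 0 →
      Real.log (BwP (p := p) Sc.L₀ Sc.m) +
          ((((S.tS Sc (lev + 1) - 1) / 2 + condExp p (2 * S.NhS Sc (lev + 1)) (S.tS Sc (lev + 1)) : ℕ)) : ℝ) * Real.log p +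
          Real.log (S.KC (S.UcardS₂ Sc) (S.PmaxS₂ Sc) Sc.L₀ Sc.H Sc.Sd (lev + 1) (S.Lb (S.sideS₂ Sc) (lev + 1)) x₁ τ) <
        (E : ℝ) * Real.log p)
    (hgain : ∀ lev < Sc.Sd, ∀ x₁ : ℤ, |x₁| ≤ (S.NS Sc (lev + 1) 1 : ℤ) → ∀ τ : Tau S.n, tauNorm τ + S.tS Sc (lev + 1) ≤ S.TordS Sc (lev + 1) 0 →
      Real.log (BwP (p := p) Sc.L₀ Sc.m) +
        Real.log (S.KC (S.UcardS₂ Sc) (S.PmaxS₂ Sc) Sc.L₀ Sc.H Sc.Sd (lev + 1) (S.Lb (S.sideS₂ Sc) (lev + 1)) x₁ τ) <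
        (((2 * S.NhS Sc (lev + 1)) * S.tS Sc (lev + 1) : ℕ) : ℝ) * (((Sc.m : ℝ) + 1 / 2) * Real.log p)) :
    ∀ lev < Sc.Sd, ∀ x₁ : ℤ, |x₁| ≤ (S.NS Sc (lev + 1) 1 : ℤ) → ∀ τ : Tau S.n, tauNorm τ + S.tS Sc (lev + 1) ≤ S.TordS Sc (lev + 1) 0 →
      max (BwP (p := p) Sc.L₀ Sc.m * ‖S.Λ / (S.b S.j₀ : ℚ_[p])‖ * (p : ℝ) ^ ((S.tS Sc (lev + 1) - 1) / 2) *
            (p : ℝ) ^ condExp p (2 * S.NhS Sc (lev + 1)) (S.tS Sc (lev + 1)))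
        (BwP (p := p) Sc.L₀ Sc.m / ((p : ℝ) ^ Sc.m * Real.sqrt p) ^ ((2 * S.NhS Sc (lev + 1)) * S.tS Sc (lev + 1))) <
      1 / S.KC (S.UcardS₂ Sc) (S.PmaxS₂ Sc) Sc.L₀ Sc.H Sc.Sd (lev + 1) (S.Lb (S.sideS₂ Sc) (lev + 1)) x₁ τ := by
  intro lev hlev x₁ hx₁ τ hτ
  exact G3OddLog.kstep_max_lt_of_lamLines S.one_lt_p (BwP_pos_aux Sc.L₀ Sc.m)
    (S.KC_pos_aux _ (S.PmaxS₂_nonneg Sc) _ _ _ _ _ _ _) hΛ (hlam lev hlev x₁ hx₁ τ hτ) (hgain lev hlev x₁ hx₁ τ hτ)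

/-- **The symmetric k-steps of the levels `≥ 1` (conjunct 5 of `IneqPackR₃`) from their two lines.** [cite: Nesterenko2003, §4.2; shape only] -/
theorem hK_of_lamLines {E : ℕ} (hΛ : ‖S.Λ / (S.b S.j₀ : ℚ_[p])‖ ≤ ((p : ℝ) ^ E)⁻¹)
    (hlam : ∀ lev < Sc.Sd, ∀ ν, 1 ≤ ν → ν < S.n → ∀ x₁ : ℤ, |x₁| ≤ (S.NS Sc (lev + 1) (ν + 1) : ℤ) →
      ∀ τ : Tau S.n, tauNorm τ + S.tS Sc (lev + 1) ≤ S.TordS Sc (lev + 1) ν →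
      Real.log (BwP (p := p) Sc.L₀ Sc.m) +
          ((((S.tS Sc (lev + 1) - 1) / 2 + condExp p (2 * S.NS Sc (lev + 1) ν + 1) (S.tS Sc (lev + 1)) : ℕ)) : ℝ) * Real.log p +
          Real.log (S.KC (S.UcardS₂ Sc) (S.PmaxS₂ Sc) Sc.L₀ Sc.H Sc.Sd (lev + 1) (S.Lb (S.sideS₂ Sc) (lev + 1)) x₁ τ) <
        (E : ℝ) * Real.log p)
    (hgain : ∀ lev < Sc.Sd, ∀ ν, 1 ≤ ν → ν < S.n → ∀ x₁ : ℤ, |x₁| ≤ (S.NS Sc (lev + 1) (ν + 1) : ℤ) →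
      ∀ τ : Tau S.n, tauNorm τ + S.tS Sc (lev + 1) ≤ S.TordS Sc (lev + 1) ν →
      Real.log (BwP (p := p) Sc.L₀ Sc.m) +
        Real.log (S.KC (S.UcardS₂ Sc) (S.PmaxS₂ Sc) Sc.L₀ Sc.H Sc.Sd (lev + 1) (S.Lb (S.sideS₂ Sc) (lev + 1)) x₁ τ) <
        (((2 * S.NS Sc (lev + 1) ν + 1) * S.tS Sc (lev + 1) : ℕ) : ℝ) * (((Sc.m : ℝ) + 1 / 2) * Real.log p)) :
    ∀ lev < Sc.Sd, ∀ ν, 1 ≤ ν → ν < S.n → ∀ x₁ : ℤ, |x₁| ≤ (S.NS Sc (lev + 1) (ν + 1) : ℤ) →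
      ∀ τ : Tau S.n, tauNorm τ + S.tS Sc (lev + 1) ≤ S.TordS Sc (lev + 1) ν →
      max (BwP (p := p) Sc.L₀ Sc.m * ‖S.Λ / (S.b S.j₀ : ℚ_[p])‖ * (p : ℝ) ^ ((S.tS Sc (lev + 1) - 1) / 2) *
            (p : ℝ) ^ condExp p (2 * S.NS Sc (lev + 1) ν + 1) (S.tS Sc (lev + 1)))
        (BwP (p := p) Sc.L₀ Sc.m / ((p : ℝ) ^ Sc.m * Real.sqrt p) ^ ((2 * S.NS Sc (lev + 1) ν + 1) * S.tS Sc (lev + 1))) <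
      1 / S.KC (S.UcardS₂ Sc) (S.PmaxS₂ Sc) Sc.L₀ Sc.H Sc.Sd (lev + 1) (S.Lb (S.sideS₂ Sc) (lev + 1)) x₁ τ := by
  intro lev hlev ν hν1 hνn x₁ hx₁ τ hτ
  exact G3OddLog.kstep_max_lt_of_lamLines S.one_lt_p (BwP_pos_aux Sc.L₀ Sc.m)
    (S.KC_pos_aux _ (S.PmaxS₂_nonneg Sc) _ _ _ _ _ _ _) hΛ (hlam lev hlev ν hν1 hνn x₁ hx₁ τ hτ)
    (hgain lev hlev ν hν1 hνn x₁ hx₁ τ hτ)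

/-! ### The Kummer half-step family (sharp currency `DCs`/`MhCs`) from its `Λ`-lines and gain lines -/

/-- **The Kummer half-steps (conjunct 3 of `IneqPackR₃`) from their two lines.** [cite: Nesterenko2003, §4.3 (4.39)–(4.45); shape only] -/
theorem hH_of_lamLines {E : ℕ} (hΛ : ‖S.Λ / (S.b S.j₀ : ℚ_[p])‖ ≤ ((p : ℝ) ^ E)⁻¹)
    (hlam : ∀ lev < Sc.Sd, ∀ s₁ : ℤ, Odd s₁ → |s₁| ≤ (2 * S.NhS Sc (lev + 1) - 1 : ℤ) → ∀ τ : Tau S.n, tauNorm τ + S.tS Sc lev ≤ S.TordS Sc lev S.n →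
      Real.log (BwP (p := p) Sc.L₀ Sc.m) +
            ((((S.tS Sc lev - 1) / 2 + condExp p (2 * S.NS Sc lev S.n + 1) (S.tS Sc lev) : ℕ)) : ℝ) * Real.log p +
            (((2 ^ (S.n + 1) : ℕ) : ℝ)) * (Real.log 4 + 2 * Real.log (S.DCs (S.Lb (S.sideS₂ Sc) lev) Sc.H s₁ τ : ℝ) +
              Real.log (1 + (S.UcardS₂ Sc : ℝ) * (S.PmaxS₂ Sc) * S.MhCs (S.Lb (S.sideS₂ Sc) lev) Sc.L₀ Sc.H Sc.Sd lev s₁ τ) +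
              3 * Real.log (CW77.heightProd S.α)) -
          Real.log (S.DCs (S.Lb (S.sideS₂ Sc) lev) Sc.H s₁ τ : ℝ) <
        (E : ℝ) * Real.log p)
    (hgain : ∀ lev < Sc.Sd, ∀ s₁ : ℤ, Odd s₁ → |s₁| ≤ (2 * S.NhS Sc (lev + 1) - 1 : ℤ) → ∀ τ : Tau S.n, tauNorm τ + S.tS Sc lev ≤ S.TordS Sc lev S.n →
      Real.log (BwP (p := p) Sc.L₀ Sc.m) +
          (((2 ^ (S.n + 1) : ℕ) : ℝ)) * (Real.log 4 + 2 * Real.log (S.DCs (S.Lb (S.sideS₂ Sc) lev) Sc.H s₁ τ : ℝ) +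
            Real.log (1 + (S.UcardS₂ Sc : ℝ) * (S.PmaxS₂ Sc) * S.MhCs (S.Lb (S.sideS₂ Sc) lev) Sc.L₀ Sc.H Sc.Sd lev s₁ τ) +
            3 * Real.log (CW77.heightProd S.α)) -
          Real.log (S.DCs (S.Lb (S.sideS₂ Sc) lev) Sc.H s₁ τ : ℝ) <
        (((2 * S.NS Sc lev S.n + 1) * S.tS Sc lev : ℕ) : ℝ) * (((Sc.m : ℝ) + 1 / 2) * Real.log p)) :
    ∀ lev < Sc.Sd, ∀ s₁ : ℤ, Odd s₁ → |s₁| ≤ (2 * S.NhS Sc (lev + 1) - 1 : ℤ) → ∀ τ : Tau S.n, tauNorm τ + S.tS Sc lev ≤ S.TordS Sc lev S.n →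
      max (BwP (p := p) Sc.L₀ Sc.m * ‖S.Λ / (S.b S.j₀ : ℚ_[p])‖ * (p : ℝ) ^ ((S.tS Sc lev - 1) / 2) *
            (p : ℝ) ^ condExp p (2 * S.NS Sc lev S.n + 1) (S.tS Sc lev))
        (BwP (p := p) Sc.L₀ Sc.m / ((p : ℝ) ^ Sc.m * Real.sqrt p) ^ ((2 * S.NS Sc lev S.n + 1) * S.tS Sc lev)) <
      (S.DCs (S.Lb (S.sideS₂ Sc) lev) Sc.H s₁ τ : ℝ) /
        (4 * (S.DCs (S.Lb (S.sideS₂ Sc) lev) Sc.H s₁ τ : ℝ) ^ 2 *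
          (1 + (S.UcardS₂ Sc : ℝ) * (S.PmaxS₂ Sc) * S.MhCs (S.Lb (S.sideS₂ Sc) lev) Sc.L₀ Sc.H Sc.Sd lev s₁ τ) *
          CW77.heightProd S.α ^ 3) ^ (2 ^ (S.n + 1)) := by
  intro lev hlev s₁ hs₁ hs₁' τ hτ
  have hD : (1 : ℝ) ≤ (S.DCs (S.Lb (S.sideS₂ Sc) lev) Sc.H s₁ τ : ℝ) := by exact_mod_cast S.one_le_DCs _ _ _ _
  have hQ : (0 : ℝ) ≤ (S.UcardS₂ Sc : ℝ) * (S.PmaxS₂ Sc) * S.MhCs (S.Lb (S.sideS₂ Sc) lev) Sc.L₀ Sc.H Sc.Sd lev s₁ τ := by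
    have hP : (0 : ℝ) ≤ (S.PmaxS₂ Sc : ℝ) := by exact_mod_cast S.PmaxS₂_nonneg Sc
    have hM := S.MhCs_nonneg (S.Lb (S.sideS₂ Sc) lev) Sc.L₀ Sc.H Sc.Sd lev s₁ τ
    positivity
  have hP : (1 : ℝ) ≤ CW77.heightProd S.α := CW77.one_le_heightProd S.α
  refine G3OddLog.half_max_lt_of_lamLines (e := 2 ^ (S.n + 1)) (E := E) S.one_lt_p (BwP_pos_aux Sc.L₀ Sc.m) hD hQ hP hΛ ?_ ?_
  · have hl := hlam lev hlev s₁ hs₁ hs₁' τ hτ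
    push_cast at hl ⊢
    exact hl
  · have hg := hgain lev hlev s₁ hs₁ hs₁' τ hτ
    push_cast at hg ⊢
    exact hg

/-! ### The pack -/

/-- **`IneqPackR₃ S Sc` from (B1) and the four families' `Λ`-lines and gain lines** under ONE smallness exponent `E`.
[cite: Nesterenko2003, Prop 4.1, Lemma 4.3, §4.3; shape only] -/
theorem ineqPackR₃_of_lamLines {E : ℕ} (hΛ : ‖S.Λ / (S.b S.j₀ : ℚ_[p])‖ ≤ ((p : ℝ) ^ E)⁻¹)
    (hB1 : 2 * (Icc (-(S.NS Sc 0 0 : ℤ)) (S.NS Sc 0 0) ×ˢ tauSetR S.n S.j₀ (S.TordS Sc 0 0)).card * ((p - 1) * p ^ Sc.m) ≤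
      (Sc.L₀ + 1) * ∏ j, (2 * S.sideS₂ Sc j + 1))
    (hlamK0 : ∀ ν < S.n, ∀ x₁ : ℤ, |x₁| ≤ (S.NS Sc 0 (ν + 1) : ℤ) → ∀ τ : Tau S.n, tauNorm τ + S.tS Sc 0 ≤ S.TordS Sc 0 ν →
      Real.log (BwP (p := p) Sc.L₀ Sc.m) +
          ((((S.tS Sc 0 - 1) / 2 + condExp p (2 * S.NS Sc 0 ν + 1) (S.tS Sc 0) : ℕ)) : ℝ) * Real.log p +
          Real.log (S.KC (S.UcardS₂ Sc) (S.PmaxS₂ Sc) Sc.L₀ Sc.H Sc.Sd 0 (S.Lb (S.sideS₂ Sc) 0) x₁ τ) <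
        (E : ℝ) * Real.log p)
    (hgainK0 : ∀ ν < S.n, ∀ x₁ : ℤ, |x₁| ≤ (S.NS Sc 0 (ν + 1) : ℤ) → ∀ τ : Tau S.n, tauNorm τ + S.tS Sc 0 ≤ S.TordS Sc 0 ν →
      Real.log (BwP (p := p) Sc.L₀ Sc.m) + Real.log (S.KC (S.UcardS₂ Sc) (S.PmaxS₂ Sc) Sc.L₀ Sc.H Sc.Sd 0 (S.Lb (S.sideS₂ Sc) 0) x₁ τ) <
        (((2 * S.NS Sc 0 ν + 1) * S.tS Sc 0 : ℕ) : ℝ) * (((Sc.m : ℝ) + 1 / 2) * Real.log p))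
    (hlamH : ∀ lev < Sc.Sd, ∀ s₁ : ℤ, Odd s₁ → |s₁| ≤ (2 * S.NhS Sc (lev + 1) - 1 : ℤ) → ∀ τ : Tau S.n, tauNorm τ + S.tS Sc lev ≤ S.TordS Sc lev S.n →
      Real.log (BwP (p := p) Sc.L₀ Sc.m) +
            ((((S.tS Sc lev - 1) / 2 + condExp p (2 * S.NS Sc lev S.n + 1) (S.tS Sc lev) : ℕ)) : ℝ) * Real.log p +
            (((2 ^ (S.n + 1) : ℕ) : ℝ)) * (Real.log 4 + 2 * Real.log (S.DCs (S.Lb (S.sideS₂ Sc) lev) Sc.H s₁ τ : ℝ) +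
              Real.log (1 + (S.UcardS₂ Sc : ℝ) * (S.PmaxS₂ Sc) * S.MhCs (S.Lb (S.sideS₂ Sc) lev) Sc.L₀ Sc.H Sc.Sd lev s₁ τ) +
              3 * Real.log (CW77.heightProd S.α)) -
          Real.log (S.DCs (S.Lb (S.sideS₂ Sc) lev) Sc.H s₁ τ : ℝ) <
        (E : ℝ) * Real.log p)
    (hgainH : ∀ lev < Sc.Sd, ∀ s₁ : ℤ, Odd s₁ → |s₁| ≤ (2 * S.NhS Sc (lev + 1) - 1 : ℤ) → ∀ τ : Tau S.n, tauNorm τ + S.tS Sc lev ≤ S.TordS Sc lev S.n →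
      Real.log (BwP (p := p) Sc.L₀ Sc.m) +
          (((2 ^ (S.n + 1) : ℕ) : ℝ)) * (Real.log 4 + 2 * Real.log (S.DCs (S.Lb (S.sideS₂ Sc) lev) Sc.H s₁ τ : ℝ) +
            Real.log (1 + (S.UcardS₂ Sc : ℝ) * (S.PmaxS₂ Sc) * S.MhCs (S.Lb (S.sideS₂ Sc) lev) Sc.L₀ Sc.H Sc.Sd lev s₁ τ) +
            3 * Real.log (CW77.heightProd S.α)) -
          Real.log (S.DCs (S.Lb (S.sideS₂ Sc) lev) Sc.H s₁ τ : ℝ) <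
        (((2 * S.NS Sc lev S.n + 1) * S.tS Sc lev : ℕ) : ℝ) * (((Sc.m : ℝ) + 1 / 2) * Real.log p))
    (hlamO : ∀ lev < Sc.Sd, ∀ x₁ : ℤ, |x₁| ≤ (S.NS Sc (lev + 1) 1 : ℤ) → ∀ τ : Tau S.n, tauNorm τ + S.tS Sc (lev + 1) ≤ S.TordS Sc (lev + 1) 0 →
      Real.log (BwP (p := p) Sc.L₀ Sc.m) +
          ((((S.tS Sc (lev + 1) - 1) / 2 + condExp p (2 * S.NhS Sc (lev + 1)) (S.tS Sc (lev + 1)) : ℕ)) : ℝ) * Real.log p +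
          Real.log (S.KC (S.UcardS₂ Sc) (S.PmaxS₂ Sc) Sc.L₀ Sc.H Sc.Sd (lev + 1) (S.Lb (S.sideS₂ Sc) (lev + 1)) x₁ τ) <
        (E : ℝ) * Real.log p)
    (hgainO : ∀ lev < Sc.Sd, ∀ x₁ : ℤ, |x₁| ≤ (S.NS Sc (lev + 1) 1 : ℤ) → ∀ τ : Tau S.n, tauNorm τ + S.tS Sc (lev + 1) ≤ S.TordS Sc (lev + 1) 0 →
      Real.log (BwP (p := p) Sc.L₀ Sc.m) +
        Real.log (S.KC (S.UcardS₂ Sc) (S.PmaxS₂ Sc) Sc.L₀ Sc.H Sc.Sd (lev + 1) (S.Lb (S.sideS₂ Sc) (lev + 1)) x₁ τ) <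
        (((2 * S.NhS Sc (lev + 1)) * S.tS Sc (lev + 1) : ℕ) : ℝ) * (((Sc.m : ℝ) + 1 / 2) * Real.log p))
    (hlamK : ∀ lev < Sc.Sd, ∀ ν, 1 ≤ ν → ν < S.n → ∀ x₁ : ℤ, |x₁| ≤ (S.NS Sc (lev + 1) (ν + 1) : ℤ) →
      ∀ τ : Tau S.n, tauNorm τ + S.tS Sc (lev + 1) ≤ S.TordS Sc (lev + 1) ν →
      Real.log (BwP (p := p) Sc.L₀ Sc.m) +
          ((((S.tS Sc (lev + 1) - 1) / 2 + condExp p (2 * S.NS Sc (lev + 1) ν + 1) (S.tS Sc (lev + 1)) : ℕ)) : ℝ) * Real.log p +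
          Real.log (S.KC (S.UcardS₂ Sc) (S.PmaxS₂ Sc) Sc.L₀ Sc.H Sc.Sd (lev + 1) (S.Lb (S.sideS₂ Sc) (lev + 1)) x₁ τ) <
        (E : ℝ) * Real.log p)
    (hgainK : ∀ lev < Sc.Sd, ∀ ν, 1 ≤ ν → ν < S.n → ∀ x₁ : ℤ, |x₁| ≤ (S.NS Sc (lev + 1) (ν + 1) : ℤ) →
      ∀ τ : Tau S.n, tauNorm τ + S.tS Sc (lev + 1) ≤ S.TordS Sc (lev + 1) ν →
      Real.log (BwP (p := p) Sc.L₀ Sc.m) +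
        Real.log (S.KC (S.UcardS₂ Sc) (S.PmaxS₂ Sc) Sc.L₀ Sc.H Sc.Sd (lev + 1) (S.Lb (S.sideS₂ Sc) (lev + 1)) x₁ τ) <
        (((2 * S.NS Sc (lev + 1) ν + 1) * S.tS Sc (lev + 1) : ℕ) : ℝ) * (((Sc.m : ℝ) + 1 / 2) * Real.log p)) :
    S.IneqPackR₃ Sc :=
  ⟨hB1, S.hK0_of_lamLines Sc hΛ hlamK0 hgainK0, S.hH_of_lamLines Sc hΛ hlamH hgainH, S.hO_of_lamLines Sc hΛ hlamO hgainO,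
    S.hK_of_lamLines Sc hΛ hlamK hgainK⟩

end G3Setup

end Summit.ABC.StewartYu

end
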